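import Literature.Algebra.GroupRings.RelativeMaschke
import Mathlib.RepresentationTheory.Basic
import Mathlib.Algebra.Module.ZMod
import Mathlib.Algebra.Field.ZMod
import Mathlib.GroupTheory.Index
import Mathlib.GroupTheory.Subgroup.Centralizer
import Mathlib.LinearAlgebra.Basis.VectorSpace
import HarnessLib

/-!
# Lam §6 Exercise 6.2: normal complements inside an elementary abelian normal `p`-subgroup, by Maschke's theorem

[cite: Lam2001FirstCourse, §6 Exercise 6.2, p. 97]

Lam, *A First Course in Noncommutative Rings*, Exercises for §6 (p. 97; p0109 of the held scan):

**Ex. 6.2.** Let `A` be a normal elementary `p`-subgroup of a finite group `G` such that the index of the centralizer `C_G(A)` is prime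
to `p`. Show that for any normal subgroup `B` of `G` lying in `A`, there exists another normal subgroup `C` of `G` lying in `A` such that
`A = B × C`. (**Hint.** Consider the conjugation action of `G` on `A` and apply Maschke's Theorem with `k = 𝔽_p`.)

Proof as hinted, through the tree's Maschke theorem RELATIVE TO A SUBGROUP (`RelativeMaschke.exists_isCompl_of_isUnit_index`, Exercise
6.1, here with `H = C_G(A)` of index prime to `p`): `A`, written additively, is an `𝔽_p G`-module under conjugation
(`Representation.asModule`); `B` is a submodule; any `𝔽_p`-complement of it is `C_G(A)`-stable because `C_G(A)` acts trivially; so `B` has an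
`𝔽_p G`-complement, i.e. a normal complement `C` in `A`.  «`A = B × C`» is rendered as `B ⊓ C = 1`, `B ⊔ C = A` (internal direct product of
the normal subgroups `B`, `C`).

## References

* [Lam2001FirstCourse] T. Y. Lam, *A First Course in Noncommutative Rings*, 2nd ed., Graduate Texts in Mathematics 131, Springer, 2001,
  §6 Exercise 6.2, p. 97 (held scan `book:lamnd-first-course-noncommutative-rings`, p0109).
-/

namespace Literature.GroupTheory

open Literature.Algebra.GroupRings MonoidAlgebra

variable {G : Type*} [Group G]

/-- **LAM Exercise 6.2: if `A ⊴ G` (`G` finite) is elementary abelian of exponent `p` and `p ∤ [G : C_G(A)]`, then every normal subgroup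
`B` of `G` inside `A` has a normal complement in `A`: a normal `C ≤ A` with `B ∩ C = 1` and `BC = A`.** [cite: Lam2001FirstCourse, §6
Exercise 6.2] -/
theorem exists_normal_compl_of_not_dvd_index_centralizer [Finite G] (p : ℕ) [Fact p.Prime] (A : Subgroup G) [hA : A.Normal]
    [IsMulCommutative A] (hAp : ∀ a ∈ A, a ^ p = 1) (hidx : ¬ p ∣ (Subgroup.centralizer (A : Set G)).index)
    (B : Subgroup G) [hB : B.Normal] (hBA : B ≤ A) :
    ∃ C : Subgroup G, C.Normal ∧ C ≤ A ∧ B ⊓ C = ⊥ ∧ B ⊔ C = A := by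
  classical
  letI : CommGroup A := { mul_comm := mul_comm' }
  -- `A`, written additively, is an `𝔽_p`-vector space
  -- (`haveI`, not `letI`: the `match` in `zmodModule` must stay folded for `LinearMap` coercions to elaborate)
  haveI : Module (ZMod p) (Additive A) := AddCommGroup.zmodModule fun x ↦ by
    have h1 : (Additive.toMul x) ^ p = 1 := Subtype.ext (by rw [Subgroup.coe_pow, Subgroup.coe_one]; exact hAp _ (Additive.toMul x).2)
    rw [← ofMul_toMul x, ← ofMul_pow, h1, ofMul_one]
  -- the conjugation action of `G` on `A`
  have hconj : ∀ (g : G) (a : A), g * (a : G) * g⁻¹ ∈ A := fun g a ↦ hA.conj_mem _ a.2 g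
  let κ : G → Additive A →+ Additive A := fun g ↦
    { toFun := fun v ↦ Additive.ofMul ⟨g * ((Additive.toMul v : A) : G) * g⁻¹, hconj g _⟩
      map_zero' := by
        rw [ofMul_eq_zero]
        exact Subtype.ext (by simp)
      map_add' := fun v w ↦ by
        rw [← ofMul_mul]
        congr 1
        exact Subtype.ext (by simp [mul_assoc]) }
  have hκ : ∀ (g : G) (v : Additive A), ((Additive.toMul (κ g v) : A) : G) = g * ((Additive.toMul v : A) : G) * g⁻¹ :=
    fun _ _ ↦ rfl
  have hκ_inj : ∀ {v w : Additive A}, ((Additive.toMul v : A) : G) = ((Additive.toMul w : A) : G) → v = w :=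
    fun h ↦ Additive.toMul.injective (Subtype.ext h)
  let ρ : Representation (ZMod p) G (Additive A) :=
    { toFun := fun g ↦ ((κ g).toZModLinearMap p : Module.End (ZMod p) (Additive A))
      map_one' := LinearMap.ext fun v ↦ by
        change κ 1 v = v
        exact hκ_inj (by rw [hκ, one_mul, inv_one, mul_one])
      map_mul' := fun g h ↦ LinearMap.ext fun v ↦ by
        change κ (g * h) v = κ g (κ h v)
        exact hκ_inj (by rw [hκ, hκ, hκ]; simp only [mul_assoc, mul_inv_rev]) }
  have hρ : ∀ (g : G) (v : Additive A), ((Additive.toMul (ρ g v) : A) : G) = g * ((Additive.toMul v : A) : G) * g⁻¹ :=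
    fun _ _ ↦ rfl
  -- `V = A` as an `𝔽_p G`-module; `A → V`
  let toV : A → ρ.asModule := fun a ↦ ρ.asModuleEquiv.symm (Additive.ofMul a)
  let ofV : ρ.asModule → A := fun v ↦ Additive.toMul (ρ.asModuleEquiv v)
  have hof_to : ∀ a, ofV (toV a) = a := fun _ ↦ rfl
  have hto_of : ∀ v, toV (ofV v) = v := fun _ ↦ rfl
  have hofV_add : ∀ v w, ofV (v + w) = ofV v * ofV w := fun _ _ ↦ rfl
  have hofV_zero : ofV 0 = 1 := rfl
  have hofV_single : ∀ (g : G) (v : ρ.asModule), ((ofV (single g (1 : ZMod p) • v) : A) : G) = g * ((ofV v : A) : G) * g⁻¹ :=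
    fun g v ↦ by
      change ((Additive.toMul (ρ.asModuleEquiv (single g (1 : ZMod p) • v)) : A) : G) = _
      rw [Representation.asModuleEquiv_map_smul, Representation.asAlgebraHom_single_one, hρ]
  -- the submodule `W₀` of elements of `B`
  let W₀ : Submodule (MonoidAlgebra (ZMod p) G) ρ.asModule :=
    { carrier := {v | ((ofV v : A) : G) ∈ B}
      zero_mem' := by
        change ((ofV 0 : A) : G) ∈ B
        rw [hofV_zero, Subgroup.coe_one]
        exact B.one_mem
      add_mem' := fun {v w} hv hw ↦ by
        change ((ofV (v + w) : A) : G) ∈ B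
        rw [hofV_add, Subgroup.coe_mul]
        exact B.mul_mem hv hw
      smul_mem' := fun x v hv ↦ by
        change ((ofV (x • v) : A) : G) ∈ B
        induction x using MonoidAlgebra.induction_linear with
        | zero => rw [zero_smul, hofV_zero, Subgroup.coe_one]; exact B.one_mem
        | add x y hx hy => rw [add_smul, hofV_add, Subgroup.coe_mul]; exact B.mul_mem hx hy
        | single g r =>
          have h1 : (single g r : MonoidAlgebra (ZMod p) G) • v = r • ((single g (1 : ZMod p) : MonoidAlgebra (ZMod p) G) • v) := by
            rw [← smul_assoc, MonoidAlgebra.smul_single, smul_eq_mul, mul_one]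
          rw [h1]
          have h2 : ((ofV (single g (1 : ZMod p) • v) : A) : G) ∈ B := by
            rw [hofV_single]
            exact hB.conj_mem _ hv g
          -- `B` (inside `V`) is an additive subgroup, hence closed under `𝔽_p`-scalars
          have h3 : (single g (1 : ZMod p) • v : ρ.asModule) ∈ (B.subgroupOf A).toAddSubgroup := h2
          exact ZMod.smul_mem (K := (B.subgroupOf A).toAddSubgroup) h3 r }
  have hW₀ : ∀ v, v ∈ W₀ ↔ ((ofV v : A) : G) ∈ B := fun _ ↦ Iff.rfl
  -- an `𝔽_p`-complement, automatically `C_G(A)`-stable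
  obtain ⟨W', hW'⟩ := @Submodule.exists_isCompl (ZMod p) ρ.asModule _ _ _ (W₀.restrictScalars (ZMod p))
  have hstab : ∀ h ∈ Subgroup.centralizer (A : Set G), ∀ w ∈ W', single h (1 : ZMod p) • w ∈ W' := by
    intro h hh w hw
    have h1 : single h (1 : ZMod p) • w = w := by
      apply hκ_inj
      change ((ofV (single h (1 : ZMod p) • w) : A) : G) = ((ofV w : A) : G)
      rw [hofV_single, ← (Subgroup.mem_centralizer_iff.1 hh _ (ofV w).2), mul_inv_cancel_right]
    rw [h1]
    exact hw
  -- Maschke relative to `C_G(A)`: an `𝔽_p G`-complement `W''`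
  have hunit : IsUnit ((Subgroup.centralizer (A : Set G)).index : ZMod p) := by
    rw [isUnit_iff_ne_zero, Ne, ZMod.natCast_eq_zero_iff]
    exact hidx
  obtain ⟨W'', hW''⟩ := exists_isCompl_of_isUnit_index (Subgroup.centralizer (A : Set G)) hunit W₀ ⟨W', hstab, hW'⟩
  -- `C = W''` as a subgroup of `G`
  let C₀ : Subgroup A :=
    { carrier := {a | toV a ∈ W''}
      one_mem' := by
        change toV 1 ∈ W''
        have h1 : toV 1 = 0 := rfl
        rw [h1]
        exact W''.zero_mem
      mul_mem' := fun {a b} ha hb ↦ by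
        change toV (a * b) ∈ W''
        have h1 : toV (a * b) = toV a + toV b := rfl
        rw [h1]
        exact W''.add_mem ha hb
      inv_mem' := fun {a} ha ↦ by
        change toV a⁻¹ ∈ W''
        have h1 : toV a⁻¹ = -toV a := rfl
        rw [h1]
        exact W''.neg_mem ha }
  have hC₀ : ∀ a, a ∈ C₀ ↔ toV a ∈ W'' := fun _ ↦ Iff.rfl
  refine ⟨C₀.map A.subtype, ⟨fun c hc g ↦ ?_⟩, Subgroup.map_subtype_le _, ?_, ?_⟩
  · -- normality: `g a g⁻¹ ↔ single g 1 • toV a`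
    obtain ⟨a, ha, rfl⟩ := Subgroup.mem_map.1 hc
    refine Subgroup.mem_map.2 ⟨⟨g * (a : G) * g⁻¹, hconj g a⟩, ?_, rfl⟩
    rw [hC₀] at ha ⊢
    have h1 : toV ⟨g * (a : G) * g⁻¹, hconj g a⟩ = single g (1 : ZMod p) • toV a := by
      apply hκ_inj
      change ((ofV (toV _) : A) : G) = ((ofV (single g (1 : ZMod p) • toV a) : A) : G)
      rw [hofV_single, hof_to, hof_to]
    rw [h1]
    exact W''.smul_mem _ ha
  · -- `B ∩ C = 1`
    refine eq_bot_iff.2 fun x hx ↦ ?_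
    obtain ⟨hxB, hxC⟩ := Subgroup.mem_inf.1 hx
    obtain ⟨a, ha, rfl⟩ := Subgroup.mem_map.1 hxC
    rw [hC₀] at ha
    have h1 : toV a ∈ W₀ := by rw [hW₀, hof_to]; exact hxB
    have h2 : toV a ∈ W₀ ⊓ W'' := Submodule.mem_inf.2 ⟨h1, ha⟩
    rw [hW''.inf_eq_bot, Submodule.mem_bot] at h2
    have h3 : a = 1 := by rw [← hof_to a, h2, hofV_zero]
    rw [Subgroup.mem_bot, h3, map_one]
  · -- `BC = A`
    refine le_antisymm (sup_le hBA (Subgroup.map_subtype_le _)) fun x hx ↦ ?_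
    have h1 : toV ⟨x, hx⟩ ∈ W₀ ⊔ W'' := by rw [hW''.sup_eq_top]; exact Submodule.mem_top
    obtain ⟨w₀, hw₀, w'', hw'', hsum⟩ := Submodule.mem_sup.1 h1
    have h2 : (⟨x, hx⟩ : A) = ofV w₀ * ofV w'' := by rw [← hofV_add, hsum, hof_to]
    have h3 : x = ((ofV w₀ : A) : G) * ((ofV w'' : A) : G) := by rw [← Subgroup.coe_mul, ← h2]
    rw [h3]
    refine Subgroup.mul_mem_sup ((hW₀ w₀).1 hw₀) (Subgroup.mem_map.2 ⟨ofV w'', ?_, rfl⟩)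
    rw [hC₀, hto_of]
    exact hw''

end Literature.GroupTheory
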